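import Literature.MathematicalPhysics.KineticTheory.HardSphereEuler
import Literature.Analysis.FluidPDE.HardSphereDynamics
import Literature.Analysis.FluidPDE.HardSphereCollisionRecord
import HarnessLib

/-!
# PROPOSED abstract robust-tracking theorem (lead c2; NOT registered — statement to be co-designed with the
# first concrete cascade instantiation)

Design-independent core of the `ignition` field of `IsIgnitionTemplate`: a hard-sphere trajectory follows a PHASE SCRIPT.
Every particle `i` has phases `0, 1, …` (time-extended phase sets `phase i k ⊆ ℝ × 𝕋³ × ℝ³`, free-flight invariant in the
pull-back form `x − t v ∈ …`), deadlines by which it must have left each phase, and designed events: its `k`-th event is a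
collision with `partner i k`, which is then in phase `pphase i k` (all events of the cascade designs are mover-hits-resting,
so one may take `pphase = 0` for the target side). Hypotheses: (sep) admissible states of non-designed pairs are never at
contact distance; (post) a designed contact from admissible pre-states, if incoming, reflects into the next phases;
(prog) admissible pre-states of a designed pair overlap (distance `< ε`) under free flight before the mover's deadline.
Conclusion: every particle is, at every time of `[0, T]`, in its current phase and before that phase's deadline; in
particular particle `i` has undergone ≥ 1 velocity jump before `deadline i 0`.
The four landed stubs (TorusIsolatedPair, ContactPerturbation, ReflectVelPerturbation, PackingOfSeparated) are what
discharges (post)/(prog) per event type and `packing`; (sep) is the layout certificate.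
-/

namespace Summit.AtomisticToContinuum.HydrodynamicLimit.Theorems.InfluenceLocality.Negative

open MeasureTheory Set
open scoped InnerProductSpace
open Literature.Analysis.FluidPDE Literature.MathematicalPhysics.KineticTheory
open Literature.Analysis.FunctionSpaces

noncomputable section

/-- Abstract phase script for `n` particles on `𝕋³` (see module docstring). -/
structure PhaseScript (n : ℕ) where
  /-- number of designed events of particle `i` (it has phases `0 … K i`) -/
  K : Fin n → ℕ
  /-- time-extended phase sets -/
  phase : Fin n → ℕ → Set (ℝ × T3 × V3)
  /-- particle `i` must have left phase `k` strictly before `deadline i k` (for `k < K i`) -/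
  deadline : Fin n → ℕ → ℝ
  /-- partner of the `k`-th designed event of `i` -/
  partner : Fin n → ℕ → Fin n
  /-- phase of that partner before the event -/
  pphase : Fin n → ℕ → ℕ

variable {n : ℕ}

/-- `(i,k)` and `(j,l)` form a designed event (in either order). -/
def PhaseScript.Designed (S : PhaseScript n) (i : Fin n) (k : ℕ) (j : Fin n) (l : ℕ) : Prop :=
  (k < S.K i ∧ S.partner i k = j ∧ S.pphase i k = l) ∨ (l < S.K j ∧ S.partner j l = i ∧ S.pphase j l = k)

/-- Validity of a phase script for diameter `ε` and horizon `T` (hypotheses (mutual), (inv), (sep), (post), (prog)). -/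
structure PhaseScript.Valid (S : PhaseScript n) (ε T : ℝ) : Prop where
  partnerMutual : ∀ i k, k < S.K i → S.partner i k ≠ i ∧ S.pphase i k < S.K (S.partner i k) + 1 ∧
    S.partner (S.partner i k) (S.pphase i k) = i ∧ S.pphase (S.partner i k) (S.pphase i k) = k ∧
    S.pphase i k < S.K (S.partner i k)
  lastDeadline : ∀ i, T < S.deadline i (S.K i)
  deadlinePos : ∀ i, 0 < S.deadline i 0
  deadlineMono : ∀ i k, S.deadline i k ≤ S.deadline i (k + 1)
  order : ∀ i k, k < S.K i → 1 ≤ S.pphase i k →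
    S.deadline (S.partner i k) (S.pphase i k - 1) ≤ S.deadline i k
  inv : ∀ i k t (x : T3) (v : V3) s, (t, x, v) ∈ S.phase i k → 0 ≤ s →
    (t + s, x + Torus.proj (s • v), v) ∈ S.phase i k
  sep : ∀ i j k l t (xi : T3) (vi : V3) (xj : T3) (vj : V3), i ≠ j → ¬ S.Designed i k j l →
    (t, xi, vi) ∈ S.phase i k → (t, xj, vj) ∈ S.phase j l → t ≤ S.deadline i k → t ≤ S.deadline j l →
    0 ≤ t → t ≤ T → ε < Torus.euclidDist xi xj
  post : ∀ i k t (xi : T3) (vi : V3) (xj : T3) (vj : V3), k < S.K i →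
    (t, xi, vi) ∈ S.phase i k → (t, xj, vj) ∈ S.phase (S.partner i k) (S.pphase i k) →
    t ≤ S.deadline i k → 0 ≤ t → t ≤ T →
    ‖(Torus.geometry (Fin 3)).sepVec xi xj‖ = ε →
    ⟪(Torus.geometry (Fin 3)).sepVec xi xj, vi - vj⟫_ℝ < 0 →
    (t, xi, (reflectVel ((Torus.geometry (Fin 3)).sepVec xi xj) (vi, vj)).1) ∈ S.phase i (k + 1) ∧
    (t, xj, (reflectVel ((Torus.geometry (Fin 3)).sepVec xi xj) (vi, vj)).2) ∈
      S.phase (S.partner i k) (S.pphase i k + 1)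
  prog : ∀ i k t (xi : T3) (vi : V3) (xj : T3) (vj : V3), k < S.K i →
    (t, xi, vi) ∈ S.phase i k → (t, xj, vj) ∈ S.phase (S.partner i k) (S.pphase i k) →
    0 ≤ t → t ≤ S.deadline i k → S.deadline i k ≤ T →
    ∃ s, 0 ≤ s ∧ t + s < S.deadline i k ∧
      Torus.euclidDist (xi + Torus.proj (s • vi)) (xj + Torus.proj (s • vj)) < ε
  chart : ∀ i k t (x : T3) (v : V3), (t, x, v) ∈ S.phase i k → 0 ≤ t → t ≤ T →
    ‖Torus.reprSym x‖ + (T - t) * ‖v‖ < 1 / 8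

/-- PROPOSED THEOREM (robust tracking, abstract). A hard-sphere trajectory starting in phase `0` everywhere follows a
valid phase script: at every time of `[0, T]` each particle is in some phase `k ≤ K i` with the time below that phase's
deadline, and its velocity has jumped at least `k` times; in particular every particle with `deadline i 0 ≤ T` changes
velocity before `deadline i 0`. (Proof plan: induction over the finite set of collision times of `γ` in `[0, T]` merged
with the deadlines; between collisions `inv`; at a collision `sep` identifies the pair as designed and `post` gives the
new phases; a deadline cannot be reached in a pre-event phase because `prog` + `stub_torusIsolatedPair` force the designed
collision first.) -/
theorem proposed_tracking {ε T : ℝ} (hε : 0 < ε) (S : PhaseScript n) (hS : S.Valid ε T)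
    {γ : ℝ → Config n (Fin 3) T3} (hγ : IsHardSphereTrajectory (Torus.geometry (Fin 3)) ε n γ)
    (h0 : ∀ i, ((0 : ℝ), (γ 0 i).1, (γ 0 i).2) ∈ S.phase i 0) :
    ∀ i, S.deadline i 0 ≤ T → ∃ t ∈ Set.Icc (0 : ℝ) (S.deadline i 0), (γ t i).2 ≠ (γ 0 i).2 := by
  sorry

end

end Summit.AtomisticToContinuum.HydrodynamicLimit.Theorems.InfluenceLocality.Negative
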